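import Literature.NumberTheory.EllipticCurves.FormalGroupMultiplicationUniversalProofs
import HarnessLib

/-!
# The Verschiebung of the formal group of a Weierstrass curve in characteristic `p`:
# `ω₀(V(s))·V'(s) = A_p · ω₀^{(p)}(s)`, hence `A_p = 0 ⇒ [p](t)` is a series in `t^{p²}`
# (height `≥ 2` at a supersingular fibre; Lazard's lemma for `V`, proofs only)

`Proofs`-style file (THEOREMS ONLY: no definition, no named fact, no instance), topic
`NumberTheory/EllipticCurves`, continuing `FormalGroupMultiplicationUniversalProofs` (which proves, over
every commutative ring, Silverman AEC IV.4.4 `[p](t) = p·f(t) + g(tᵖ)` — `g = formalMulFrobPart W p`, a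
lift of the Verschiebung — and Katz–Mazur 12.4.2 `g'(0) = [tᵖ][p] ≡ A_p (mod p)`, `A_p = hasseCoeff`).

For a Weierstrass curve `V` over a commutative ring `S` of (odd prime) characteristic `p`, with
`ω₀ = formalInvDiff V = Σ wₙ tⁿ` the normalised invariant differential of `Ê` and `g = formalMulFrobPart V p`
(so `[p](t) = g(tᵖ)` exactly, `formalMul_prime_eq_expand_of_charP`), we prove:

* `formalInvDiff_subst_formalMulFrobPart_mul_derivative` — **the differential identity of the
  Verschiebung**: `ω₀(g(s)) · g'(s) = A_p · Σₙ wₙᵖ sⁿ`. This is Silverman AEC IV.4.3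
  (`ω_G(φ(T))·φ'(T) = φ'(0)·ω_F(T)` for a homomorphism `φ : F → G`) for the Verschiebung
  `V : Ê^{(p)} → Ê`, whose source has invariant differential `ω₀^{(p)} = Σ wₙᵖ sⁿ` and whose linear term
  is the Hasse invariant `A_p` (Katz–Mazur 12.4.2). PROOF without two-variable calculus: over the
  universal ring `ℤ[aᵢ]`, `ω₀([p])·[p]' = p·ω₀` (tree, AEC IV.4.3 for `[p]`) and `[p] = p f + g(tᵖ)` give,
  after cancelling `p`, `ω₀([p](t))·(f'(t) + t^{p-1} g'(tᵖ)) = ω₀(t)`; modulo `p`, `ω₀([p]) = (ω₀ ∘ g)(tᵖ)`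
  is a series in `tᵖ` and `f'` has no coefficients in degrees `≡ -1 (mod p)`, so the coefficients of
  `t^{kp-1}` read `[s^{k-1}]((ω₀ ∘ g)·g') = w_{kp-1}`, and `w_{kp-1} = A_p·w_{k-1}ᵖ` is the tree's
  characteristic-`p` identity `coeff_formalInvDiff_mul_prime` (Atkin–Swinnerton-Dyer at level one /
  Deuring). The universal identity over `𝔽_p[aᵢ]` is then specialised to `S`.
* `derivative_formalMulFrobPart_eq_zero_of_hasseCoeff_eq_zero`,
  `coeff_formalMulFrobPart_eq_zero_of_hasseCoeff_eq_zero` — **Lazard's lemma for the Verschiebung**: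
  if `A_p = 0` (supersingular fibre) then `g' = 0`, i.e. `g(s) = h(sᵖ)` (`[sᵐ]g = 0` for `p ∤ m`);
* `coeff_formalMul_prime_eq_zero_of_hasseCoeff_eq_zero`, `formalMul_prime_eq_expand_sq_of_hasseCoeff_eq_zero`
  — **height `≥ 2`**: if `A_p = 0` then `[tⁿ][p] = 0` unless `p² ∣ n`, i.e. `[p](t) = h(t^{p²})`
  (Silverman AEC IV.7.4–7.5 / V.3.1(a): at a supersingular fibre the formal group has height `2`; here
  the inequality `ht ≥ 2`, which is what valuation estimates of `p`-power torsion use: every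
  coefficient of `[p]` below degree `p²` of a lift to a local ring with this residue curve lies in the
  maximal ideal — Serre, Driebergen 1966, §5 Lemme 3, hypothesis «`aₙ ∈ 𝔪` pour `n < p^h`»).

What is NOT here: the converse / exact height (`[t^{p²}][p] ≠ 0`, AEC IV.7.5), the identification
`A_p = 0 ⟺ p ∣ a_q` with the trace of Frobenius over `𝔽_q` (AEC V.4.1(a)), `p = 2`.

## References

* J. H. Silverman, *The Arithmetic of Elliptic Curves*, 2nd ed., GTM 106 (2009), IV.4.3, IV.4.4,
  IV.7.1–7.5, V.3.1(a), V.4.1(a). [SilvermanAEC2009]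
* N. M. Katz, B. Mazur, *Arithmetic Moduli of Elliptic Curves* (1985), 12.4.2 (Verschiebung and Hasse
  invariant). [folklore]
* M. Lazard, *Sur les groupes de Lie formels à un paramètre*, Bull. SMF 83 (1955), Lemme 3 / §III
  (the height of a homomorphism in characteristic `p`). [folklore]
* J.-P. Serre, *Sur les groupes de Galois attachés aux groupes p-divisibles*, Proc. Conf. Local Fields
  (Driebergen 1966), Springer 1967, §5 (Prop. 8, Lemme 3: `aₙ ∈ 𝔪` for `n < p^h`). [Serre1967GroupesPDivisibles]
-/

noncomputable section

open scoped Classical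

namespace WeierstrassCurve

open PowerSeries Literature.NumberTheory.EllipticCurves

section Helpers

variable {R : Type*} [CommRing R]

/-- Coefficients of `expand p φ · ψ` in degree `k·p + r`, `r < p`, when `ψ` has no coefficient in the
degrees `≡ r (mod p)` below: only the terms `[t^{lp}]φ · [t^{(k-l)p + r}]ψ` survive. Used with
`ψ = f'` (no coefficients in degrees `≡ -1 (mod p)` in characteristic `p`). Private plumbing. [folklore] -/
private theorem coeff_expand_mul_eq_zero_of_forall (p : ℕ) (hp : p ≠ 0) (φ ψ : R⟦X⟧) (r k : ℕ)
    (hr : r < p) (hψ : ∀ j : ℕ, PowerSeries.coeff (j * p + r) ψ = 0) :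
    PowerSeries.coeff (k * p + r) (PowerSeries.expand p hp φ * ψ) = 0 := by
  rw [PowerSeries.coeff_mul]
  refine Finset.sum_eq_zero fun ij hij => ?_
  obtain ⟨i, j⟩ := ij
  have hsum : i + j = k * p + r := Finset.mem_antidiagonal.mp hij
  by_cases hpi : p ∣ i
  · obtain ⟨l, rfl⟩ := hpi
    -- then `j = (k - l) * p + r`
    have hlk : l ≤ k := by
      by_contra h
      have : k * p + r < p * l := by
        calc k * p + r < k * p + p := by omega
          _ = (k + 1) * p := by ring
          _ ≤ l * p := Nat.mul_le_mul_right _ (by omega)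
          _ = p * l := by ring
      omega
    have hj : j = (k - l) * p + r := by
      have : j = k * p + r - p * l := by omega
      rw [this, Nat.sub_mul]
      have : l * p ≤ k * p := Nat.mul_le_mul_right _ hlk
      rw [mul_comm p l]
      omega
    rw [hj, hψ, mul_zero]
  · rw [PowerSeries.coeff_expand_of_not_dvd p hp _ hpi, zero_mul]

/-- `[t^{kp + (p-1)}](t^{p-1} · expand p φ) = [sᵏ]φ`. [folklore] -/
private theorem coeff_X_pow_mul_expand (p : ℕ) (hp : p ≠ 0) (φ : R⟦X⟧) (k : ℕ) :
    PowerSeries.coeff (k * p + (p - 1)) (PowerSeries.X ^ (p - 1) * PowerSeries.expand p hp φ) =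
      PowerSeries.coeff k φ := by
  rw [show k * p + (p - 1) = p * k + (p - 1) by ring, PowerSeries.coeff_X_pow_mul,
    PowerSeries.coeff_expand_mul]

/-- In characteristic `p`, a derivative has no coefficients in the degrees `≡ -1 (mod p)`:
`[t^{jp + (p-1)}] ψ' = (jp + p)·[t^{(j+1)p}]ψ = 0`. [folklore] -/
private theorem coeff_derivative_eq_zero_of_charP (p : ℕ) [Fact p.Prime] [CharP R p] (ψ : R⟦X⟧) (j : ℕ) :
    PowerSeries.coeff (j * p + (p - 1)) (d⁄dX R ψ) = 0 := by
  have hp1 : 1 ≤ p := (Fact.out : p.Prime).one_lt.le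
  rw [PowerSeries.coeff_derivative]
  have hcast : ((j * p + (p - 1) : ℕ) : R) + 1 = (((j + 1) * p : ℕ) : R) := by
    have h : j * p + (p - 1) + 1 = (j + 1) * p := by
      rw [Nat.add_mul, one_mul]; omega
    rw [← h]; push_cast; ring
  rw [hcast, Nat.cast_mul, CharP.cast_eq_zero R p, mul_zero, mul_zero]

/-- In characteristic `p` (prime), a natural number prime to `p` is a unit. [folklore] -/
private theorem isUnit_natCast_of_not_dvd (p : ℕ) [Fact p.Prime] [CharP R p] {m : ℕ} (hm : ¬ p ∣ m) :
    IsUnit (m : R) := by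
  have hp : p.Prime := Fact.out
  have hcop : Nat.Coprime m p := (Nat.coprime_comm.mp ((Nat.Prime.coprime_iff_not_dvd hp).mpr hm))
  have hu : IsUnit ((m : ZMod p)) := (ZMod.unitOfCoprime m hcop).isUnit
  have h := hu.map (ZMod.castHom (dvd_refl p) R)
  rwa [map_natCast] at h

end Helpers

section Universal

variable (p : ℕ) [hp : Fact p.Prime]

/-- **The differential identity of the Verschiebung, universally over `𝔽_p[a₁,…,a₆]`**: for the
reduction `Ū` of the universal Weierstrass equation modulo `p` (odd), with `ω₀ = Σ wₙtⁿ = formalInvDiff Ū`,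
`g = formalMulFrobPart Ū p` (`[p](t) = g(tᵖ)`), `A = hasseCoeff Ū p`:
`ω₀(g(s))·g'(s) = A · Σₙ wₙᵖ sⁿ`. [Silverman AEC IV.4.3–4.4 with Katz–Mazur 12.4.2]
[cite: SilvermanAEC2009, IV.4.3] -/
theorem formalInvDiff_subst_formalMulFrobPart_mul_derivative_universal (hp2 : p ≠ 2) :
    ((universalInt.map (MvPolynomial.map (Int.castRingHom (ZMod p)))).formalInvDiff.subst
        ((universalInt.map (MvPolynomial.map (Int.castRingHom (ZMod p)))).formalMulFrobPart p)) *
      d⁄dX (MvPolynomial (Fin 5) (ZMod p))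
        ((universalInt.map (MvPolynomial.map (Int.castRingHom (ZMod p)))).formalMulFrobPart p) =
    PowerSeries.C ((universalInt.map (MvPolynomial.map (Int.castRingHom (ZMod p)))).hasseCoeff p) *
      PowerSeries.mk fun n => (PowerSeries.coeff n
        (universalInt.map (MvPolynomial.map (Int.castRingHom (ZMod p)))).formalInvDiff) ^ p := by
  have hpp : p.Prime := Fact.out
  have hp0 : p ≠ 0 := hpp.ne_zero
  obtain ⟨m, hpm⟩ : ∃ m, p = 2 * m + 1 := hpp.eq_two_or_odd'.resolve_left hp2
  set 𝓡 := MvPolynomial (Fin 5) ℤ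
  set U : WeierstrassCurve 𝓡 := universalInt with hU
  set F := U.formalMul p with hF
  set ω₀ := U.formalInvDiff with hω
  set f : 𝓡⟦X⟧ := formalMulPPartUniv p with hf
  set g := U.formalMulFrobPart p with hg
  set u := ω₀.subst F with hu
  set E := d⁄dX 𝓡 f + PowerSeries.X ^ (p - 1) * PowerSeries.expand p hp0 (d⁄dX 𝓡 g) with hE
  -- `[p] = p f + g(tᵖ)` universally
  have hdec : F = (p : 𝓡⟦X⟧) * f + PowerSeries.expand p hp0 g := by
    have h := U.formalMul_prime_eq_add_expand p
    rw [formalMulPPart, hU, universalEval_universalInt, PowerSeries.map_id] at h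
    exact h
  -- `[p]' = p • E`
  have hD : d⁄dX 𝓡 F = (p : 𝓡⟦X⟧) * E := by
    rw [hdec, map_add, derivative_expand, hE]
    have h1 : d⁄dX 𝓡 ((p : 𝓡⟦X⟧) * f) = (p : 𝓡⟦X⟧) * d⁄dX 𝓡 f := by
      rw [← nsmul_eq_mul, map_nsmul, nsmul_eq_mul]
    rw [h1]; ring
  -- cancel `p`: `u * E = ω₀`
  have key : u * E = ω₀ := by
    have h := U.formalInvDiff_subst_formalMul_mul_derivative' p
    rw [← hF, ← hω, ← hu, hD, nsmul_eq_mul] at h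
    have h' : (p : 𝓡⟦X⟧) * (u * E - ω₀) = 0 := by rw [mul_sub, ← h]; ring
    exact sub_eq_zero.mp ((mul_eq_zero.mp h').resolve_left (natCast_powerSeries_universal_ne_zero hp0))
  -- reduce modulo `p`
  set 𝓕 := MvPolynomial (Fin 5) (ZMod p)
  set π : 𝓡 →+* 𝓕 := MvPolynomial.map (Int.castRingHom (ZMod p)) with hπ
  set Uπ := U.map π with hUπ
  set gπ := Uπ.formalMulFrobPart p with hgπ
  set ωπ := Uπ.formalInvDiff with hωπ
  have hgπ0 : PowerSeries.constantCoeff gπ = 0 := Uπ.constantCoeff_formalMulFrobPart p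
  have hπg : PowerSeries.map π g = gπ := by rw [hg, map_formalMulFrobPart]
  have hπω : PowerSeries.map π ω₀ = ωπ := by rw [hω, map_formalInvDiff]
  -- `π u = (ω₀' ∘ g')(tᵖ)`
  have hπu : PowerSeries.map π u = PowerSeries.expand p hp0 (ωπ.subst gπ) := by
    rw [hu, hF, hω, powerSeries_map_subst _ (U.hasSubst_formalMul p), map_formalInvDiff, map_formalMul,
      formalMul_prime_eq_expand_of_charP p (U.map π), subst_expand_eq_expand_subst p hp0 _ hgπ0]
  -- `π E = (π f)' + t^{p-1} · expand p (gπ')`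
  have hπE : PowerSeries.map π E = d⁄dX 𝓕 (PowerSeries.map π f) +
      PowerSeries.X ^ (p - 1) * PowerSeries.expand p hp0 (d⁄dX 𝓕 gπ) := by
    rw [hE, map_add, map_mul, ← derivative_map, map_pow, PowerSeries.map_X, PowerSeries.map_expand,
      ← derivative_map, hπg]
  -- the reduced identity `π u · π E = ωπ`
  have keyπ : PowerSeries.expand p hp0 (ωπ.subst gπ) *
      (d⁄dX 𝓕 (PowerSeries.map π f) + PowerSeries.X ^ (p - 1) * PowerSeries.expand p hp0 (d⁄dX 𝓕 gπ)) =
        ωπ := by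
    have h := congrArg (PowerSeries.map π) key
    rwa [map_mul, hπu, hπE, hπω] at h
  -- compare the coefficients of `t^{kp + (p-1)}`
  ext k
  have h := congrArg (PowerSeries.coeff (k * p + (p - 1))) keyπ
  rw [mul_add, map_add, coeff_expand_mul_eq_zero_of_forall p hp0 _ _ (p - 1) k (by omega)
      (fun j => coeff_derivative_eq_zero_of_charP p _ j), zero_add,
    ← mul_assoc, mul_comm (PowerSeries.expand p hp0 _) (PowerSeries.X ^ (p - 1)), mul_assoc,
    ← map_mul, coeff_X_pow_mul_expand, Uπ.coeff_formalInvDiff_mul_prime p hpm k] at h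
  rw [h, PowerSeries.coeff_C_mul, PowerSeries.coeff_mk]

end Universal

section CharP

variable {S : Type*} [CommRing S] (p : ℕ) [hp : Fact p.Prime] [CharP S p] (V : WeierstrassCurve S)

/-- The evaluation `𝔽_p[aᵢ] → S` at the coefficients of `V` (characteristic `p`), through which
`universalEval` factors. Private plumbing. [folklore] -/
private theorem exists_eval_comp_eq :
    ∃ ev : MvPolynomial (Fin 5) (ZMod p) →+* S,
      ev.comp (MvPolynomial.map (Int.castRingHom (ZMod p))) = V.universalEval := by
  refine ⟨MvPolynomial.eval₂Hom (ZMod.castHom (dvd_refl p) S)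
    (fun i => V.universalEval (MvPolynomial.X i)), ?_⟩
  refine MvPolynomial.ringHom_ext (fun r => ?_) (fun i => ?_)
  · have h1 : ((MvPolynomial.eval₂Hom (ZMod.castHom (dvd_refl p) S)
        (fun i => V.universalEval (MvPolynomial.X i))).comp
        (MvPolynomial.map (Int.castRingHom (ZMod p)))).comp MvPolynomial.C =
        V.universalEval.comp MvPolynomial.C := RingHom.ext_int _ _
    exact RingHom.congr_fun h1 r
  · rw [RingHom.comp_apply, MvPolynomial.map_X, MvPolynomial.coe_eval₂Hom, MvPolynomial.eval₂_X]

/-- **The differential identity of the Verschiebung over every ring of odd prime characteristic `p`**: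
`ω₀(g(s))·g'(s) = A_p · Σₙ wₙᵖ sⁿ`, where `[p](t) = g(tᵖ)` (`g = formalMulFrobPart V p`,
`formalMul_prime_eq_expand_of_charP`), `ω₀ = formalInvDiff V = Σ wₙ tⁿ` and `A_p = hasseCoeff V p` —
Silverman AEC IV.4.3 for the Verschiebung `V : Ê^{(p)} → Ê` (`V'(0) = A_p`, Katz–Mazur 12.4.2;
`ω_{Ê^{(p)}} = ω₀^{(p)}`). [cite: SilvermanAEC2009, IV.4.3] -/
theorem formalInvDiff_subst_formalMulFrobPart_mul_derivative (hp2 : p ≠ 2) :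
    (V.formalInvDiff.subst (V.formalMulFrobPart p)) * d⁄dX S (V.formalMulFrobPart p) =
      PowerSeries.C (V.hasseCoeff p) * PowerSeries.mk fun n => (PowerSeries.coeff n V.formalInvDiff) ^ p := by
  obtain ⟨ev, hev⟩ := exists_eval_comp_eq p V
  set π : MvPolynomial (Fin 5) ℤ →+* MvPolynomial (Fin 5) (ZMod p) :=
    MvPolynomial.map (Int.castRingHom (ZMod p)) with hπ
  set Uπ := universalInt.map π with hUπ
  have hV : Uπ.map ev = V := by rw [hUπ, map_map, hev, universalInt_map]
  have huniv := formalInvDiff_subst_formalMulFrobPart_mul_derivative_universal p hp2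
  rw [← hπ, ← hUπ] at huniv
  have h := congrArg (PowerSeries.map ev) huniv
  rw [map_mul, powerSeries_map_subst _ (PowerSeries.HasSubst.of_constantCoeff_zero'
      (Uπ.constantCoeff_formalMulFrobPart p)), ← derivative_map, map_formalInvDiff, map_formalMulFrobPart,
    hV, map_mul, PowerSeries.map_C, ← map_hasseCoeff, hV] at h
  rw [h]
  congr 1
  ext n
  rw [PowerSeries.coeff_map, PowerSeries.coeff_mk, PowerSeries.coeff_mk, map_pow, ← PowerSeries.coeff_map,
    map_formalInvDiff, hV]

/-- **Lazard's lemma for the Verschiebung**: at a fibre of Hasse invariant `A_p = 0` (supersingular),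
`g' = 0` for `[p](t) = g(tᵖ)` — from the differential identity, `ω₀(g(s))` being a unit (`ω₀(0) = 1`).
[Silverman AEC IV.7.2 (proof), Lazard 1955] [cite: SilvermanAEC2009, IV.7.2] -/
theorem derivative_formalMulFrobPart_eq_zero_of_hasseCoeff_eq_zero (hp2 : p ≠ 2)
    (hA : V.hasseCoeff p = 0) : d⁄dX S (V.formalMulFrobPart p) = 0 := by
  have h := V.formalInvDiff_subst_formalMulFrobPart_mul_derivative p hp2
  rw [hA, map_zero, zero_mul] at h
  have hunit : IsUnit (V.formalInvDiff.subst (V.formalMulFrobPart p)) := by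
    refine PowerSeries.isUnit_iff_constantCoeff.mpr ?_
    rw [constantCoeff_subst_eq_constantCoeff (V.constantCoeff_formalMulFrobPart p),
      constantCoeff_formalInvDiff]
    exact isUnit_one
  exact (hunit.mul_right_eq_zero).mp h

/-- **`g(s) = h(sᵖ)` at a supersingular fibre**: if `A_p = 0` then `[sᵐ]g = 0` for every `m` prime to
`p` (`g' = 0` and `m` is a unit in characteristic `p`). [Silverman AEC IV.7.2, Lazard 1955]
[cite: SilvermanAEC2009, IV.7.2] -/
theorem coeff_formalMulFrobPart_eq_zero_of_hasseCoeff_eq_zero (hp2 : p ≠ 2)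
    (hA : V.hasseCoeff p = 0) {m : ℕ} (hm : ¬ p ∣ m) :
    PowerSeries.coeff m (V.formalMulFrobPart p) = 0 := by
  have hm0 : m ≠ 0 := fun h => hm (h ▸ dvd_zero p)
  obtain ⟨n, rfl⟩ := Nat.exists_eq_succ_of_ne_zero hm0
  have h := congrArg (PowerSeries.coeff n)
    (V.derivative_formalMulFrobPart_eq_zero_of_hasseCoeff_eq_zero p hp2 hA)
  rw [PowerSeries.coeff_derivative, map_zero] at h
  have hu : IsUnit ((n.succ : ℕ) : S) := isUnit_natCast_of_not_dvd p hm
  rw [Nat.cast_succ] at hu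
  exact (hu.mul_left_eq_zero).mp h

/-- **Height `≥ 2` at a supersingular fibre**: if `A_p = 0` then `[tⁿ][p] = 0` unless `p² ∣ n`
(`[p](t) = g(tᵖ)` with `g(s) = h(sᵖ)`). [Silverman AEC IV.7.4–7.5, V.3.1(a)]
[cite: SilvermanAEC2009, IV.7.5] -/
theorem coeff_formalMul_prime_eq_zero_of_hasseCoeff_eq_zero (hp2 : p ≠ 2)
    (hA : V.hasseCoeff p = 0) {n : ℕ} (hn : ¬ p ^ 2 ∣ n) :
    PowerSeries.coeff n (V.formalMul p) = 0 := by
  rw [formalMul_prime_eq_expand_of_charP p V, PowerSeries.coeff_expand]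
  split_ifs with hpn
  · apply V.coeff_formalMulFrobPart_eq_zero_of_hasseCoeff_eq_zero p hp2 hA
    intro h
    apply hn
    obtain ⟨q, hq⟩ := hpn
    rw [hq, Nat.mul_div_cancel_left _ hp.out.pos] at h
    rw [hq, sq]
    exact Nat.mul_dvd_mul_left p h
  · rfl

/-- **`[p](t) = h(t^{p²})` at a supersingular fibre** (`A_p = 0`), with
`h(r) = Σⱼ [s^{pj}]g · rʲ`. [Silverman AEC IV.7.5, V.3.1(a)] [cite: SilvermanAEC2009, IV.7.5] -/
theorem formalMul_prime_eq_expand_sq_of_hasseCoeff_eq_zero (hp2 : p ≠ 2) (hA : V.hasseCoeff p = 0) :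
    V.formalMul p = PowerSeries.expand (p ^ 2) (pow_ne_zero 2 hp.out.ne_zero)
      (PowerSeries.mk fun j => PowerSeries.coeff (p * j) (V.formalMulFrobPart p)) := by
  ext n
  rw [PowerSeries.coeff_expand]
  split_ifs with h
  · obtain ⟨q, rfl⟩ := h
    rw [Nat.mul_div_cancel_left _ (pow_pos hp.out.pos 2), PowerSeries.coeff_mk,
      formalMul_prime_eq_expand_of_charP p V, sq, mul_assoc, PowerSeries.coeff_expand_mul]
  · exact V.coeff_formalMul_prime_eq_zero_of_hasseCoeff_eq_zero p hp2 hA h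

end CharP

section Lift

variable {O : Type*} [CommRing O] (p : ℕ) [hp : Fact p.Prime] (I : Ideal O) [CharP (O ⧸ I) p]
  (W : WeierstrassCurve O)

/-- **Serre's hypothesis «`aₙ ∈ 𝔪` for `n < p²`» (Driebergen 1966, §5 Lemme 3 with `h = 2`) at a
supersingular fibre**: for a Weierstrass equation `W` over a ring `O` and an ideal `I` with `O/I` of odd
prime characteristic `p`, if the reduction `W mod I` has Hasse invariant `0`, then every coefficient of
`[p]_W(t) = Σ aₙ tⁿ` with `p² ∤ n` lies in `I` (the multiplication-by-`p` series commutes with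
reduction, `map_formalMul`). For `O` the valuation ring of a local field of good supersingular
reduction and `I = 𝔪` this is the input of the valuation estimates for `p`-power torsion
(`v([p]x) ≥ min(p² v(x), v(x) + v(𝔪))`). [cite: Serre1967GroupesPDivisibles, §5 Lemme 3]
[cite: SilvermanAEC2009, IV.7.5] -/
theorem coeff_formalMul_prime_mem_of_hasseCoeff_reduction_eq_zero (hp2 : p ≠ 2)
    (hA : (W.map (Ideal.Quotient.mk I)).hasseCoeff p = 0) {n : ℕ} (hn : ¬ p ^ 2 ∣ n) :
    PowerSeries.coeff n (W.formalMul p) ∈ I := by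
  rw [← Ideal.Quotient.eq_zero_iff_mem, ← PowerSeries.coeff_map, map_formalMul]
  exact (W.map (Ideal.Quotient.mk I)).coeff_formalMul_prime_eq_zero_of_hasseCoeff_eq_zero p hp2 hA hn

end Lift

end WeierstrassCurve

end
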